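import Literature.AnabelianGeometry.SemiGraphs.CoverticialCoveringDoubleCoset
import Literature.AnabelianGeometry.SemiGraphs.CoverticialCoveringBranchCount
import Literature.AnabelianGeometry.SemiGraphs.BranchSubgroupFrames
import Literature.AnabelianGeometry.Anabelioids.FiberFunctorUnique
import Literature.AnabelianGeometry.Anabelioids.ComponentsOfObjects
import HarnessLib

/-!
# Branches of a finite étale covering over a branch: the double-coset dictionary — PROOF

Mochizuki, *Semi-graphs of anabelioids*, Publ. RIMS **42** (2006) 221–322, §2, Definition 2.2 (i)
p. 23, Remark 2.2.1 p. 24, Remark 2.4.1 p. 26 [cite: MochizukiSemiAnbd2006, Def. 2.2(i) p.23].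

PROOF-ONLY (abc-iut cell, L3 row G23 (d) step 2, abc-iut-L6-t17): the named fact
`covering_branchFibre_doubleCosets` (abc-iut-L3-t1, `CoverticialCoveringDoubleCoset.lean`) is
PROVED under its hypotheses `Hom.IsFiniteEtaleCoveringOf A` (local description) and
`Hom.IsBranchAligned` (ruling μ2, abc-iut-L4-t17 — without it the EQUALITY clause fails on twisted
coverings, findings L4t17-F1 / F-L6t17g3-1: S₄/D₄ open-edge twist).

Assembly (`covering_branchFibre_doubleCosets_holds`): `d(b')` := the transport element of the
ALIGNED frame of `b'` (`BranchSubgroupFrames.lean`); the equality clause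
`ι(Π_{b'}) = ι(Π_{v'}) ⊓ x Π_b x⁻¹` from alignment (i), the representative moving `x` inside its
double coset by `alignIso_transition_eq`; injectivity of `b' ↦ ι(Π_{v'})·d(b')·Π_b` from alignment
(ii) via `transportAut_mul_inv_eq`; surjectivity from the twist-insensitive COUNT
`covering_branchFibre_doubleCosets_count` (`CoverticialCoveringBranchCount.lean`, local predicate
only) and finiteness of the set of branches over `b` at `v'`.
-/

namespace Literature.AnabelianGeometry.SemiGraphs

open CategoryTheory CategoryTheory.Limits CategoryTheory.Functor CategoryTheory.PreGaloisCategory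
open Literature.AnabelianGeometry.Anabelioids
open scoped Pointwise

universe v₁ u₁ u

namespace SemiGraphOfAnabelioids

variable {𝒢 𝒢' : SemiGraphOfAnabelioids.{v₁, u₁, u}}

/-! ### Group-theoretic bookkeeping -/

section Group

variable {G : Type*} [Group G]

/-- Two elements define the same double coset `H \ G / K` iff their quotient `x₁ x₂⁻¹` lies in the
product set `(x₁ K x₁⁻¹) · H`. [cite: MochizukiSemiAnbd2006, Rem. 2.2.1 p.24] -/
private theorem doubleCoset_mk_eq_iff_mul_inv (H K : Subgroup G) (x₁ x₂ : G) :
    DoubleCoset.mk H K x₁ = DoubleCoset.mk H K x₂ ↔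
      ∃ k ∈ ConjAct.toConjAct x₁ • K, ∃ h ∈ H, x₁ * x₂⁻¹ = k * h := by
  rw [DoubleCoset.eq]
  constructor
  · rintro ⟨h, hh, k, hk, rfl⟩
    refine ⟨x₁ * k⁻¹ * x₁⁻¹, ?_, h⁻¹, H.inv_mem hh, by group⟩
    rw [Subgroup.mem_smul_pointwise_iff_exists]
    exact ⟨k⁻¹, K.inv_mem hk, by simp [ConjAct.smul_def, mul_assoc]⟩
  · rintro ⟨k, hk, h, hh, hx⟩
    rw [Subgroup.mem_smul_pointwise_iff_exists] at hk
    obtain ⟨k₀, hk₀, rfl⟩ := hk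
    refine ⟨h⁻¹, H.inv_mem hh, k₀⁻¹, K.inv_mem hk₀, ?_⟩
    simp only [ConjAct.smul_def, ConjAct.ofConjAct_toConjAct] at hx
    calc x₂ = (x₁ * x₂⁻¹)⁻¹ * x₁ := by group
      _ = (x₁ * k₀ * x₁⁻¹ * h)⁻¹ * x₁ := by rw [hx]
      _ = h⁻¹ * x₁ * k₀⁻¹ := by group

end Group

/-! ### Assembly -/

/-- The branches of `𝒢'` over `b` at `v'` form a finite set (they inject, via their edges and `cE`,
into the connected components of `T_e`). [cite: MochizukiSemiAnbd2006, Def. 2.2(i) p.23] -/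
private theorem finite_branchesOver (φ : Hom 𝒢' 𝒢) (A : 𝒢.BObj) (hφ : φ.IsFiniteEtaleCoveringOf A)
    (v' : 𝒢'.graph.Vertex) (b : 𝒢.graph.Branch) :
    Finite {b' : 𝒢'.graph.Branch // φ.base.branchMap b' = b ∧ 𝒢'.graph.abuts b' = some v'} := by
  obtain ⟨-, -, cE, -, hEbij, -, -, -⟩ := hφ
  haveI : Finite (π₀Obj (A.T (𝒢.graph.edgeOf b))) := finite_connectedSubobject _
  have he : ∀ b' : {b' : 𝒢'.graph.Branch // φ.base.branchMap b' = b ∧ 𝒢'.graph.abuts b' = some v'},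
      𝒢.graph.edgeOf b = φ.base.edgeMap (𝒢'.graph.edgeOf b'.1) := fun b' => by
    have h1 := φ.base.edgeOf_branchMap b'.1
    rw [b'.2.1] at h1
    exact h1
  refine Finite.of_injective
    (fun b' => ((he b') ▸ cE (𝒢'.graph.edgeOf b'.1) : π₀Obj (A.T (𝒢.graph.edgeOf b)))) ?_
  intro b₁ b₂ hR
  have h1 : ∀ b' : {b' : 𝒢'.graph.Branch // φ.base.branchMap b' = b ∧ 𝒢'.graph.abuts b' = some v'},
      (⟨𝒢.graph.edgeOf b, ((he b') ▸ cE (𝒢'.graph.edgeOf b'.1) : π₀Obj (A.T (𝒢.graph.edgeOf b)))⟩ :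
        Σ e, π₀Obj (A.T e)) = ⟨φ.base.edgeMap (𝒢'.graph.edgeOf b'.1), cE (𝒢'.graph.edgeOf b'.1)⟩ := by
    intro b'
    generalize he b' = h
    revert h
    generalize 𝒢.graph.edgeOf b = e
    rintro rfl
    rfl
  have hS := (h1 b₁).symm.trans ((congrArg _ hR).trans (h1 b₂))
  exact Subtype.ext (φ.base.branchMap_injOn _ _ (hEbij.1 hS) (b₁.2.1.trans b₂.2.1.symm))

/-- NAMED FACT `covering_branchFibre_doubleCosets` (abc-iut-L3-t1), PROVED: along a finite étale
covering `φ : 𝒢' → 𝒢` attached to `A` whose branch functors are ALIGNED (`Hom.IsBranchAligned`),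
for a vertex `v'` over `v` and a branch `b ∋ v`, the branches of `𝒢'` over `b` at `v'` correspond
bijectively to the double cosets `ι(Π_{v'}) \ Π_v / Π_b`, and the branch group of such a `b'` maps
under `ι` onto `ι(Π_{v'}) ∩ x Π_b x⁻¹` for an `x` in the double coset of `b'` (for every
representative of `Π_{b'}`). [cite: MochizukiSemiAnbd2006, Def. 2.2(i) p.23] -/
theorem covering_branchFibre_doubleCosets_holds : covering_branchFibre_doubleCosets.{v₁, u₁, u} := by
  intro 𝒢 𝒢' φ A hφ hal v' F' _ F _ β b h Fe _ α ι Pb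
  classical
  -- notation
  let B' := {b' : 𝒢'.graph.Branch // φ.base.branchMap b' = b ∧ 𝒢'.graph.abuts b' = some v'}
  let P := (𝒢.pull b (φ.base.vertexMap v') h).pullback
  let E : ∀ b' : B', 𝒢.E (𝒢.graph.edgeOf b) ⥤ 𝒢'.E (𝒢'.graph.edgeOf b'.1) := fun b' =>
    (φ.φE (𝒢'.graph.edgeOf b'.1) (𝒢.graph.edgeOf b)
      (φ.edgeMap_edgeOf_eq_of_branchMap_eq b b'.1 b'.2.1)).pullback
  obtain ⟨-, hal2⟩ := hal v' F' b
  -- reference frames: for every `b'` an edge basepoint `Fe₀ b'`, `α₀ b'`, `δ₀ b'`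
  let Fe₀ : ∀ b' : B', 𝒢'.E (𝒢'.graph.edgeOf b'.1) ⥤ FintypeCat.{v₁} := fun b' =>
    GaloisCategory.getFiberFunctor _
  haveI hFe₀ : ∀ b' : B', FiberFunctor (Fe₀ b') := fun b' =>
    (inferInstance : FiberFunctor (GaloisCategory.getFiberFunctor _))
  have hα₀ : ∀ b' : B', Nonempty ((𝒢'.pull b'.1 v' b'.2.2).pullback ⋙ Fe₀ b' ≅ F') := fun b' => by
    haveI : FiberFunctor ((𝒢'.pull b'.1 v' b'.2.2).pullback ⋙ Fe₀ b') :=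
      fiberFunctor_comp_of_exact _ _
    exact nonempty_iso_of_fiberFunctor _ _
  let α₀ : ∀ b' : B', (𝒢'.pull b'.1 v' b'.2.2).pullback ⋙ Fe₀ b' ≅ F' := fun b' =>
    Classical.choice (hα₀ b')
  have hδ₀ : ∀ b' : B', Nonempty (E b' ⋙ Fe₀ b' ≅ Fe) := fun b' => by
    haveI : FiberFunctor (E b' ⋙ Fe₀ b') := fiberFunctor_comp_of_exact _ _
    exact nonempty_iso_of_fiberFunctor _ _
  let δ₀ : ∀ b' : B', E b' ⋙ Fe₀ b' ≅ Fe := fun b' => Classical.choice (hδ₀ b')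
  -- the transport element of the aligned frame of `b'`
  let d : B' → Aut F := fun b' =>
    transportAut α ((isoWhiskerLeft P (δ₀ b')).symm ≪≫
      φ.alignIso b'.1 v' b'.2.2 b b'.2.1 F' (Fe₀ b') (α₀ b') ≪≫ β)
  -- `Aut(β)` carries the aligned branch subgroup of `b'` onto `d(b') • Π_b`
  have hKmap : ∀ b' : B',
      (φ.alignedBranchSubgroup b'.1 v' b'.2.2 b b'.2.1 F' (Fe₀ b') (α₀ b')).map
          (Aut.autMulEquivOfIso β).toMonoidHom = ConjAct.toConjAct (d b') • Pb := by
    intro b'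
    rw [Hom.alignedBranchSubgroup, branchSubgroup_map_autMulEquivOfIso]
    exact branchSubgroup_eq_conjAct_smul_of_edgeIso 𝒢 b h (δ₀ b') _ α
  -- injectivity of `b' ↦ ι(Π_{v'}) · d(b') · Π_b` — alignment (ii)
  have hinj : Function.Injective (fun b' : B' => DoubleCoset.mk ι.range Pb (d b')) := by
    intro b₁ b₂ h12
    by_contra hne
    have hne' : b₁.1 ≠ b₂.1 := fun hh => hne (Subtype.ext hh)
    obtain ⟨k, hk, g, hg, hkg⟩ := (doubleCoset_mk_eq_iff_mul_inv ι.range Pb (d b₁) (d b₂)).mp h12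
    rw [← hKmap b₁] at hk
    obtain ⟨q, hq, rfl⟩ := hk
    obtain ⟨u, rfl⟩ := hg
    have ht := transportAut_mul_inv_eq 𝒢 b h β (δ₀ b₁) (δ₀ b₂)
      (φ.alignIso b₁.1 v' b₁.2.2 b b₁.2.1 F' (Fe₀ b₁) (α₀ b₁))
      (φ.alignIso b₂.1 v' b₂.2.2 b b₂.2.1 F' (Fe₀ b₂) (α₀ b₂)) α
    rw [hkg, MulEquiv.coe_toMonoidHom, MonoidHom.coe_comp, Function.comp_apply,
      MulEquiv.coe_toMonoidHom, ← map_mul] at ht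
    exact hal2 b₁.1 b₂.1 b₁.2.2 b₂.2.2 b₁.2.1 b₂.2.1 hne' (Fe₀ b₁) (α₀ b₁) (Fe₀ b₂) (α₀ b₂)
      (δ₀ b₂ ≪≫ (δ₀ b₁).symm) q hq u ((Aut.autMulEquivOfIso β).injective ht).symm
  refine ⟨d, ⟨hinj, ?_⟩, ?_⟩
  · -- surjectivity: the twist-insensitive COUNT and finiteness of the branches over `b` at `v'`
    obtain ⟨d₀, hd₀⟩ := covering_branchFibre_doubleCosets_count φ A hφ v' F' F β b h Fe α
    haveI : Finite B' := finite_branchesOver φ A hφ v' b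
    let e := Equiv.ofBijective _ hd₀
    have hsurj : Function.Surjective (fun b' : B' => e.symm (DoubleCoset.mk ι.range Pb (d b'))) :=
      Finite.surjective_of_injective (e.symm.injective.comp hinj)
    intro c
    obtain ⟨b', hb'⟩ := hsurj (e.symm c)
    exact ⟨b', e.symm.injective hb'⟩
  · -- the equality clause — alignment (i); the frame change stays inside the double coset
    intro b' Fe' _ α'
    haveI : FiberFunctor (E b' ⋙ Fe') := fiberFunctor_comp_of_exact _ _
    obtain ⟨θ''⟩ := nonempty_iso_of_fiberFunctor (Fe₀ b') Fe'
    let δ : E b' ⋙ Fe' ≅ Fe := (isoWhiskerLeft (E b') θ'').symm ≪≫ δ₀ b'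
    let x : Aut F := transportAut α ((isoWhiskerLeft P δ).symm ≪≫
      φ.alignIso b'.1 v' b'.2.2 b b'.2.1 F' Fe' α' ≪≫ β)
    refine ⟨x, ?_, ?_⟩
    · -- same double coset as `d b'`
      rw [doubleCoset_mk_eq_iff_mul_inv]
      refine ⟨1, Subgroup.one_mem _, ι ((α₀ b').symm ≪≫
        isoWhiskerLeft (𝒢'.pull b'.1 v' b'.2.2).pullback θ'' ≪≫ α'), ⟨_, rfl⟩, ?_⟩
      have ht := transportAut_mul_inv_eq 𝒢 b h β δ (δ₀ b')
        (φ.alignIso b'.1 v' b'.2.2 b b'.2.1 F' Fe' α')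
        (φ.alignIso b'.1 v' b'.2.2 b b'.2.1 F' (Fe₀ b') (α₀ b')) α
      have hθ : δ₀ b' ≪≫ δ.symm = isoWhiskerLeft (E b') θ'' := by
        simp only [δ, Iso.trans_symm, Iso.symm_symm_eq, Iso.self_symm_id_assoc]
      rw [hθ, alignIso_transition_eq] at ht
      rw [one_mul]
      exact ht
    · -- `ι(Π_{b'}) = ι(Π_{v'}) ⊓ x • Π_b`
      rw [map_branchSubgroup_eq_inf_of_aligned φ hal v' F' b b'.1 b'.2.2 b'.2.1 Fe' α' β h,
        branchSubgroup_eq_conjAct_smul_of_edgeIso 𝒢 b h δ _ α]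

end SemiGraphOfAnabelioids

end Literature.AnabelianGeometry.SemiGraphs
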